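import Summits.BirchSwinnertonDyer.Rank1Residual.Additive.X4RankZeroUpperHalfOfShaDvd
import Summits.BirchSwinnertonDyer.Rank1Residual.Additive.ShaDvdConstantCoeffOfNoFiniteSubmodule
import Summits.BirchSwinnertonDyer.Rank1Residual.Additive.GordCycLowerBoundOfControlTamagawaSharp
import HarnessLib

/-!
# X4♯(G-ord) ∩ `I₀*`, rank `0`, big image, `B = 0` rows: the UPPER half and `BSD(E,p)` with
# Delbourgo 1998 Prop. 4 REPLACED by Greenberg's Prop. 4.14 record + control
# (team n1011, row T-CTL-UP, seat p06 GEN 11, FILE 3b — the Prop-4.14 supplier plugged into FILE 3a)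

HONEST FRAMING (cell `b2b-bsdres-*`, team n1011, verbatim): prove what is provable now; shrink each
hard class to its core with data; no claim beyond stated classes. Research route on
CONSTRUCTION-SHAPED X4 / §I N10–N11; ASSEMBLY theorems only — no definition, no named fact, nothing
booked, no residual-map mark moved, no class closed. X4♯(G-ord) stays CONSTRUCTION-SHAPED: the typed
`χ_p`-branch inputs / the LOWER half stay OPEN exactly as in additive-p2's gen-7/12 ENDs; what changes
is ONE named fact in the binder list.

## What

additive-p2's `ClassX4Gord.missingUpperBoundAt_rankZero_of_katoComponent` (gen 12,
`GordRankZeroKatoComponent`) delivers `ord_p #Ш(E) ≤ ord_p #Ш_an(E)` on X4♯(G-ord) ∩ `I₀*`, `r_an = 0`,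
`ρ̄_{E,p}` onto (`ram(3)` at `p = 3`), from the named facts {Kato 17.4 (3) component reading (`hK`),
**Delbourgo 1998 Prop. 4 (`hDel`)**, GZK, modularity (`hmod`, `hmodD`)}. Here the same conclusion is
re-derived with `hDel` REPLACED by {**Greenberg's Prop. 4.14 record `h414`** (already consumed on these
rows by route G's budget road), the census place data `S / hgood`, and **`hB : p ∤ Tam(E)` (`B = 0`)**}
through FILE 3a's abstracted cores and FILE 2's supplier
`isTorsion_and_pow_dvd_constantCoeff_mul_sq_of_prop414`; the socket above `p` (FINITENESS of
`𝒦_{v,0}[p^∞]`) is p12's T-T3B F7 `GoodModelLine.ClassX4Gord.localTowerKerPrimary_zero_eq_bot` (= ⊥,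
every `ℤ_p`-extension) and `p ∤ #E(ℚ)_tors` is `Irr` (`Supersingular.not_dvd_torsionOrder_of_irr`):

* `shaDvdAt_of_prop414` — FILE 2 in FILE 3a's supplier shape (`Tam`-form of `B = 0`);
* `X4RankZeroTwistEven.missingUpperBoundAt_of_surj_of_prop414` (`p ≡ 1 (mod 4)`),
  `X4RankZeroTwistOdd.padicValNat_shaOrder_le_shaAn_of_prop414` / `…missingUpperBoundAt_of_surj_of_prop414`
  (`p ≡ 3 (mod 4)`, `p ≠ 3`) / `…_of_surj_of_ram_of_prop414` (every `p ≡ 3 (mod 4)`), glued in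
  `X4RankZeroTwist.missingUpperBoundAt_of_odd_prime_of_surj_of_prop414` — additive-p4's V9b chain with
  `hDel ↦ (h414, S, hSp, hgood, hB)`;
* **`ClassX4Gord.missingUpperBoundAt_rankZero_of_katoComponent_of_prop414`** — X4♯(G-ord) ∩ `I₀*`,
  `r_an = 0`, `ρ̄` onto (`ram(3)` if `p = 3`), `p ∤ Tam(E)`: `MissingUpperBoundAt W p` from
  {`hK`, `h414`, `hGZK`, `hmod`, `hmodD`} + `S / hgood` — binder diff against additive-p2's END:
  REMOVED {`hDel`}, ADDED {`h414`, `S`, `hgood`, `hB`};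
  `…bsdp_rankZero_of_katoComponent_of_prop414_of_shaAn_unit` (`p ∤ #Ш_an`),
  `…missingInputAt_iff_lower_…`, `…bsdp_rankZero_of_katoComponent_of_lower_of_prop414`, and the
  capstone with T-CTL-TAM's lower half `…_of_cycLowerBound_tamagawaSharp_of_prop414` (typed input
  `CycLowerBoundAt` + {`hK`, `h414`, GZK, modularity}: NO Delbourgo 1998/2002 anywhere).

Scope: Prop. 4.14's printed proof covers potentially ordinary / multiplicative reduction at `p` — the
X4♯(G-ord) column sits inside (record docstring, referee-1 R12.1). NOT claimed: `B ≥ 1` rows (there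
`hDel`'s Tamagawa exponent is global duality); the (M) / X3 twins (same mechanics, owners' call).
Axioms standard.

References: [Kato2004Asterisque] Thm. 17.4 (3); [GreenbergLNM1716] §4 Thm. 4.1, Prop. 4.14;
[Delbourgo1998] Prop. 4 (REPLACED); [Miller2011LMS] Def. 1.1; cells/n1011/skel/T-CTL-UP.md.
-/

noncomputable section

open scoped Classical MatrixGroups ModularForm NumberField

open CongruenceSubgroup WeierstrassCurve Literature.NumberTheory.EllipticCurves
  Literature.NumberTheory.EllipticCurves.ModularForms
  Literature.NumberTheory.EllipticCurves.Rank1Residual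
  Summit.BirchSwinnertonDyer.Rank1Residual.Iwasawa

namespace Summit.BirchSwinnertonDyer.Rank1Residual.Additive

open IsDedekindDomain NumberField Rat.HeightOneSpectrum
  Literature.NumberTheory.EllipticCurves.Rank1Residual.Typed

section Supplier

variable (W : WeierstrassCurve ℚ) [W.IsElliptic] [W.IsGloballyMinimal] (p : ℕ) [hp : Fact p.Prime]

/-- **The Prop-4.14 supplier in FILE 3a's shape (`Tam`-form of `B = 0`).** `p ∤ #E(ℚ)_tors`, a
finite place set `S ⊇ {p} ∪ {bad}` with the level-`0` kernels FINITE above `p` for every cyclotomic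
`κ`, `hgood`, and `p ∤ Tam(E)` ⟹ the pointwise divisibility `hdivAt` of FILE 3a (FILE 2's
`isTorsion_and_pow_dvd_constantCoeff_mul_sq_of_prop414`; `∏ᶠ_{v∤p} c_v ∣ Tam`).
[cite: GreenbergLNM1716, §4 Thm. 4.1 (proof, pp. 102–104) and Prop. 4.14] -/
theorem shaDvdAt_of_prop414 (h414 : Greenberg1999.prop414_noFiniteSubmodule_of_not_dvd_torsionOrder)
    (htors : ¬ p ∣ W.torsionOrder) (S : Finset (HeightOneSpectrum (𝓞 ℚ)))
    (hSp : ∀ κ : ZpExtension ℚ p, κ.IsCyclotomic → ∀ v ∈ S, (p : 𝓞 ℚ) ∈ v.asIdeal →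
      Finite (W.localTowerKerPrimary κ (v.adicCompletion ℚ) 0))
    (hgood : ∀ v ∉ S, (p : 𝓞 ℚ) ∉ v.asIdeal ∧ W.HasGoodReductionAt v)
    (hB : ¬ p ∣ W.tamagawaProduct) :
    ∀ (κ : ZpExtension ℚ p) (γ : Field.absoluteGaloisGroup ℚ), κ.IsCyclotomic →
      κ.IsTopGenerator γ → ∀ D : W.SelmerDualData κ γ, Finite W.sha → Finite W.toAffine.Point →
      ∀ g ∈ D.charIdeal,
        (p : ℤ_[p]) ^ (padicValNat p (Nat.card (AddCommGroup.primaryComponent W.sha p)) +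
            padicValNat p (∏ᶠ v : HeightOneSpectrum (𝓞 ℚ),
              if (p : 𝓞 ℚ) ∈ v.asIdeal then 1 else W.tamagawaNumberAt v)) ∣
          PowerSeries.constantCoeff g * ((Nat.card W.toAffine.Point : ℕ) : ℤ_[p]) ^ 2 := by
  intro κ γ hκ hγ D hfin hE
  have hB' : ¬ p ∣ ∏ᶠ v : HeightOneSpectrum (𝓞 ℚ),
      (if (p : 𝓞 ℚ) ∈ v.asIdeal then 1 else W.tamagawaNumberAt v) := fun h ↦
    hB (h.trans (Dvd.intro_left _ (tamagawaProduct_eq_tamagawaNumberAt_mul_finprod W p).symm))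
  exact (isTorsion_and_pow_dvd_constantCoeff_mul_sq_of_prop414 W p h414 htors S hSp hgood hB' hfin hE
    κ γ hκ hγ D).2

end Supplier

section X4

variable (W : WeierstrassCurve ℚ) [W.IsElliptic] [W.IsGloballyMinimal] (p : ℕ) [hp : Fact p.Prime]

/-- **Even branch (`p ≡ 1 (mod 4)`), image hypothesis `surj(p)` of `E`: `Typed.MissingUpperBoundAt W p`**
on X4 ∧ `r_an = 0` ∧ (semistable twist `W = C • V^{(p)}`, `V` good ordinary or multiplicative at `p`),
granted `ChiBranchLeadingTermBigImageAt W p`, from the Prop-4.14 supplier (binders `h414 S hSp hgood hB`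
in place of `hDel`; `p ∤ #E(ℚ)_tors` from `Irr`). [cite: Kato2004Asterisque, Thm. 17.4] [cite: GreenbergLNM1716, Prop. 4.14] -/
theorem X4RankZeroTwistEven.missingUpperBoundAt_of_surj_of_prop414
    (h414 : Greenberg1999.prop414_noFiniteSubmodule_of_not_dvd_torsionOrder)
    (hGZK : rank_eq_analyticRank_of_analyticRank_le_one) (hmod : hasEntireLFunction_rat)
    (hBC : ChiBranchLeadingTermBigImageAt W p)
    (hp4 : p % 4 = 1) (hr : W.analyticRank = 0) (hX : ClassX4 W p) (hsurj : Surj W p)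
    (S : Finset (HeightOneSpectrum (𝓞 ℚ)))
    (hSp : ∀ κ : ZpExtension ℚ p, κ.IsCyclotomic → ∀ v ∈ S, (p : 𝓞 ℚ) ∈ v.asIdeal →
      Finite (W.localTowerKerPrimary κ (v.adicCompletion ℚ) 0))
    (hgood : ∀ v ∉ S, (p : 𝓞 ℚ) ∉ v.asIdeal ∧ W.HasGoodReductionAt v) (hB : ¬ p ∣ W.tamagawaProduct)
    (V : WeierstrassCurve ℚ) [V.IsElliptic] [V.IsGloballyMinimal]
    (C : VariableChange ℚ) (hC : C • V.quadraticTwist (p : ℚ) = W) (hV : GoodOrd V p ∨ Mult V p)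
    {N : ℕ} [NeZero N] {f : CuspForm (Gamma0 N) 2} (hf : IsNewformOf V f)
    (ϖ : ℚ) (hϖ : (ϖ : ℝ) * V.realPeriodRat = plusPeriod f) :
    MissingUpperBoundAt W p :=
  AdditiveTwistEven.missingUpperBoundAt_of_leadingTerm_of_shaDvd W p
    (shaDvdAt_of_prop414 W p h414 (Supersingular.not_dvd_torsionOrder_of_irr W p hX.2.2) S hSp hgood hB)
    hGZK hmod hp4 hr hX.2.1 V C hC hV hf ϖ hϖ
    fun _ _ hκ hγ hγ' D ↦ (hBC V hp4 ⟨C, hC⟩ hV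
      (X4RankZeroTwistEven.forall_surj_pow_twist_of_surj W p hp4 V C hC hsurj) hκ hγ hγ' hf D ϖ hϖ).2

/-- **Odd branch (`p ≡ 3 (mod 4)`): `#Ш_an = q` with `ord_p #Ш(E) ≤ ord_p q`** on X4 ∧ `r_an = 0` ∧
(semistable twist `W = C • V^{(−p)}`, `V` good ordinary or multiplicative at `p`, `ρ̄_{V,pⁿ}` onto
for all `n`), granted `ChiBranchLeadingTermOddBigImageAt W p`, from the Prop-4.14 supplier
(`c_p(E)` is a `p`-unit on these rows: `not_dvd_tamagawaNumberAt_twist_pm_p`).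
[cite: Kato2004Asterisque, Thm. 17.4] [cite: GreenbergLNM1716, Prop. 4.14] -/
theorem X4RankZeroTwistOdd.padicValNat_shaOrder_le_shaAn_of_prop414
    (h414 : Greenberg1999.prop414_noFiniteSubmodule_of_not_dvd_torsionOrder)
    (hGZK : rank_eq_analyticRank_of_analyticRank_le_one) (hmod : hasEntireLFunction_rat)
    (hBC : ChiBranchLeadingTermOddBigImageAt W p)
    (hp4 : p % 4 = 3) (hr : W.analyticRank = 0) (hX : ClassX4 W p)
    (S : Finset (HeightOneSpectrum (𝓞 ℚ)))
    (hSp : ∀ κ : ZpExtension ℚ p, κ.IsCyclotomic → ∀ v ∈ S, (p : 𝓞 ℚ) ∈ v.asIdeal →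
      Finite (W.localTowerKerPrimary κ (v.adicCompletion ℚ) 0))
    (hgood : ∀ v ∉ S, (p : 𝓞 ℚ) ∉ v.asIdeal ∧ W.HasGoodReductionAt v) (hB : ¬ p ∣ W.tamagawaProduct)
    (V : WeierstrassCurve ℚ) [V.IsElliptic] [V.IsGloballyMinimal]
    (C : VariableChange ℚ) (hC : C • V.quadraticTwist (-(p : ℚ)) = W) (hV : GoodOrd V p ∨ Mult V p)
    (hsurj : ∀ n : ℕ, V.HasSurjectiveModNGaloisRep (p ^ n : ℕ))
    {N : ℕ} [NeZero N] {f : CuspForm (Gamma0 N) 2} (hf : IsNewformOf V f)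
    (ϖ : ℚ) (hϖ : (ϖ : ℝ) * V.imaginaryPeriodRat = minusPeriod f) :
    ∃ q : ℚ, shaAn W = (q : ℂ) ∧ (padicValNat p W.shaOrder : ℤ) ≤ padicValRat p q := by
  have hp2 : p ≠ 2 := by omega
  have hC' : C • V.quadraticTwist (((-(p : ℤ)) : ℤ) : ℚ) = W := by push_cast; exact hC
  have hu : padicValRat p (C.u : ℚ) = 0 :=
    padicValRat_u_eq_zero_of_twist_pm_p p hp2 V W (hV.elim (fun h ↦ Or.inl h.1) Or.inr)
      (Or.inr rfl) C hC'
  obtain ⟨q, hq, hle⟩ := AdditiveTwistOdd.shaOrder_le_of_leadingTerm_of_shaDvd W p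
    (shaDvdAt_of_prop414 W p h414 (Supersingular.not_dvd_torsionOrder_of_irr W p hX.2.2) S hSp hgood hB)
    hGZK hmod hp4 hr hX.2.1 V C hC hu hf ϖ hϖ
    fun _ _ hκ hγ hγ' D ↦ (hBC V hp4 ⟨C, hC⟩ hV hsurj hκ hγ hγ' hf D ϖ hϖ).2
  have htam := not_dvd_tamagawaNumberAt_twist_pm_p p hp2 V (hV.elim (fun h ↦ Or.inl h.1) Or.inr)
    (d := -(p : ℚ)) (Or.inr rfl) C hC
  refine ⟨q, hq, ?_⟩
  rw [padicValNat.eq_zero_of_not_dvd htam, Nat.cast_zero, add_zero] at hle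
  exact hle

omit [W.IsElliptic] [W.IsGloballyMinimal] in
/-- `p ≡ 3 (mod 4)` and `p ≠ 3` give `p ≥ 5`. [folklore] -/
private theorem five_le_of_mod_four_eq_three_of_ne_three' (hp4 : p % 4 = 3) (hp3 : p ≠ 3) :
    5 ≤ p := by
  have h2 := hp.out.two_le
  by_contra h
  interval_cases p <;> simp_all

omit [W.IsElliptic] [W.IsGloballyMinimal] hp in
/-- `p ≡ 3 (mod 4)` gives `−p = 4k + 1` with `k = −(p+1)/4`. [folklore] -/
private theorem neg_eq_four_mul_add_one' (hp4 : p % 4 = 3) :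
    (-(p : ℤ)) = 4 * (-((p / 4 : ℕ) : ℤ) - 1) + 1 := by
  have h := Nat.div_add_mod p 4
  push_cast
  omega

/-- **Odd branch, `p ≠ 3`, image hypothesis `surj(p)` of `E`: `Typed.MissingUpperBoundAt W p`** from
the Prop-4.14 supplier (Serre lifts `surj(p)` to `ρ̄_{V,pⁿ}` onto, `p ≥ 7`).
[cite: SerreAbelianLadic1968, Ch. IV §3.4, Lemma 3] [cite: GreenbergLNM1716, Prop. 4.14] -/
theorem X4RankZeroTwistOdd.missingUpperBoundAt_of_surj_of_prop414
    (h414 : Greenberg1999.prop414_noFiniteSubmodule_of_not_dvd_torsionOrder)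
    (hGZK : rank_eq_analyticRank_of_analyticRank_le_one) (hmod : hasEntireLFunction_rat)
    (hBC : ChiBranchLeadingTermOddBigImageAt W p)
    (hp4 : p % 4 = 3) (hp3 : p ≠ 3) (hr : W.analyticRank = 0) (hX : ClassX4 W p) (hsurj : Surj W p)
    (S : Finset (HeightOneSpectrum (𝓞 ℚ)))
    (hSp : ∀ κ : ZpExtension ℚ p, κ.IsCyclotomic → ∀ v ∈ S, (p : 𝓞 ℚ) ∈ v.asIdeal →
      Finite (W.localTowerKerPrimary κ (v.adicCompletion ℚ) 0))
    (hgood : ∀ v ∉ S, (p : 𝓞 ℚ) ∉ v.asIdeal ∧ W.HasGoodReductionAt v) (hB : ¬ p ∣ W.tamagawaProduct)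
    (V : WeierstrassCurve ℚ) [V.IsElliptic] [V.IsGloballyMinimal]
    (C : VariableChange ℚ) (hC : C • V.quadraticTwist (-(p : ℚ)) = W) (hV : GoodOrd V p ∨ Mult V p)
    {N : ℕ} [NeZero N] {f : CuspForm (Gamma0 N) 2} (hf : IsNewformOf V f)
    (ϖ : ℚ) (hϖ : (ϖ : ℝ) * V.imaginaryPeriodRat = minusPeriod f) :
    MissingUpperBoundAt W p := by
  obtain ⟨q, hq, hle⟩ := X4RankZeroTwistOdd.padicValNat_shaOrder_le_shaAn_of_prop414 W p h414 hGZK hmod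
    hBC hp4 hr hX S hSp hgood hB V C hC hV
    (X4RankZeroTwistOdd.forall_surj_pow_twist_of_surj W p
      (five_le_of_mod_four_eq_three_of_ne_three' p hp4 hp3) V
      (neg_ne_zero.mpr (Nat.cast_ne_zero.mpr hp.out.ne_zero)) C hC hsurj) hf ϖ hϖ
  exact ⟨q, hq, hle⟩

/-- **Odd branch, every `p ≡ 3 (mod 4)` incl. `p = 3`, under `surj(p) ∧ ram(p)`:
`Typed.MissingUpperBoundAt W p`** from the Prop-4.14 supplier (the `p`-adic surjectivity of `E♭` is
`forall_surj_pow_of_twist_pStar_of_surj_of_ram`). [cite: GreenbergLNM1716, Prop. 4.14] [cite: Kato2004Asterisque, Thm. 17.4] -/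
theorem X4RankZeroTwistOdd.missingUpperBoundAt_of_surj_of_ram_of_prop414
    (h414 : Greenberg1999.prop414_noFiniteSubmodule_of_not_dvd_torsionOrder)
    (hGZK : rank_eq_analyticRank_of_analyticRank_le_one) (hmod : hasEntireLFunction_rat)
    (hBC : ChiBranchLeadingTermOddBigImageAt W p)
    (hp4 : p % 4 = 3) (hr : W.analyticRank = 0) (hX : ClassX4 W p) (hsurj : Surj W p) (hram : Ram W p)
    (S : Finset (HeightOneSpectrum (𝓞 ℚ)))
    (hSp : ∀ κ : ZpExtension ℚ p, κ.IsCyclotomic → ∀ v ∈ S, (p : 𝓞 ℚ) ∈ v.asIdeal →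
      Finite (W.localTowerKerPrimary κ (v.adicCompletion ℚ) 0))
    (hgood : ∀ v ∉ S, (p : 𝓞 ℚ) ∉ v.asIdeal ∧ W.HasGoodReductionAt v) (hB : ¬ p ∣ W.tamagawaProduct)
    (V : WeierstrassCurve ℚ) [V.IsElliptic] [V.IsGloballyMinimal]
    (C : VariableChange ℚ) (hC : C • V.quadraticTwist (-(p : ℚ)) = W) (hV : GoodOrd V p ∨ Mult V p)
    {N : ℕ} [NeZero N] {f : CuspForm (Gamma0 N) 2} (hf : IsNewformOf V f)
    (ϖ : ℚ) (hϖ : (ϖ : ℝ) * V.imaginaryPeriodRat = minusPeriod f) :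
    MissingUpperBoundAt W p := by
  have hC' : C • V.quadraticTwist (((-(p : ℤ)) : ℤ) : ℚ) = W := by push_cast; exact hC
  obtain ⟨q, hq, hle⟩ := X4RankZeroTwistOdd.padicValNat_shaOrder_le_shaAn_of_prop414 W p h414 hGZK hmod
    hBC hp4 hr hX S hSp hgood hB V C hC hV
    (forall_surj_pow_of_twist_pStar_of_surj_of_ram p V (neg_eq_four_mul_add_one' p hp4) (Or.inr rfl)
      C hC' hsurj hram) hf ϖ hϖ
  exact ⟨q, hq, hle⟩

/-- **Both parities glued, every odd `p`: `Typed.MissingUpperBoundAt W p`** on X4 ∧ `r_an = 0` with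
`W = C • V^{(p*)}`, `p* = (−1)^{⌊p/2⌋} p`, `V` good ordinary or multiplicative at `p`, `surj(p)` for `E`
plus `ram(p)` when `p = 3`, granted the typed inputs of both parities — additive-p4's
`X4RankZeroTwist.missingUpperBoundAt_of_odd_prime_of_surj` with `hDel ↦ (h414, S, hSp, hgood, hB)`.
[cite: Kato2004Asterisque, Thm. 17.4] [cite: GreenbergLNM1716, Prop. 4.14] -/
theorem X4RankZeroTwist.missingUpperBoundAt_of_odd_prime_of_surj_of_prop414
    (h414 : Greenberg1999.prop414_noFiniteSubmodule_of_not_dvd_torsionOrder)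
    (hGZK : rank_eq_analyticRank_of_analyticRank_le_one) (hmod : hasEntireLFunction_rat)
    (hBCeven : ChiBranchLeadingTermBigImageAt W p) (hBCodd : ChiBranchLeadingTermOddBigImageAt W p)
    (hp2 : p ≠ 2) (hr : W.analyticRank = 0) (hX : ClassX4 W p) (hsurj : Surj W p)
    (hram3 : p = 3 → Ram W p) (S : Finset (HeightOneSpectrum (𝓞 ℚ)))
    (hSp : ∀ κ : ZpExtension ℚ p, κ.IsCyclotomic → ∀ v ∈ S, (p : 𝓞 ℚ) ∈ v.asIdeal →
      Finite (W.localTowerKerPrimary κ (v.adicCompletion ℚ) 0))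
    (hgood : ∀ v ∉ S, (p : 𝓞 ℚ) ∉ v.asIdeal ∧ W.HasGoodReductionAt v) (hB : ¬ p ∣ W.tamagawaProduct)
    (V : WeierstrassCurve ℚ) [V.IsElliptic] [V.IsGloballyMinimal]
    (C : VariableChange ℚ) (hC : C • V.quadraticTwist ((-1 : ℚ) ^ (p / 2) * p) = W)
    (hV : GoodOrd V p ∨ Mult V p)
    {N : ℕ} [NeZero N] {f : CuspForm (Gamma0 N) 2} (hf : IsNewformOf V f)
    (ϖp : ℚ) (hϖp : (ϖp : ℝ) * V.realPeriodRat = plusPeriod f)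
    (ϖm : ℚ) (hϖm : (ϖm : ℝ) * V.imaginaryPeriodRat = minusPeriod f) :
    MissingUpperBoundAt W p := by
  have hodd : p % 4 = 1 ∨ p % 4 = 3 := by
    obtain ⟨k, hk⟩ := hp.out.odd_of_ne_two hp2
    omega
  rcases hodd with h1 | h3
  · have hC' : C • V.quadraticTwist (p : ℚ) = W := by
      rw [pStar_eq_of_mod_four p (Or.inl h1), if_pos h1] at hC
      exact hC
    exact X4RankZeroTwistEven.missingUpperBoundAt_of_surj_of_prop414 W p h414 hGZK hmod hBCeven h1 hr hX
      hsurj S hSp hgood hB V C hC' hV hf ϖp hϖp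
  · have hC' : C • V.quadraticTwist (-(p : ℚ)) = W := by
      rw [pStar_eq_of_mod_four p (Or.inr h3), if_neg (by omega)] at hC
      exact hC
    by_cases hp3 : p = 3
    · exact X4RankZeroTwistOdd.missingUpperBoundAt_of_surj_of_ram_of_prop414 W p h414 hGZK hmod hBCodd
        h3 hr hX hsurj (hram3 hp3) S hSp hgood hB V C hC' hV hf ϖm hϖm
    · exact X4RankZeroTwistOdd.missingUpperBoundAt_of_surj_of_prop414 W p h414 hGZK hmod hBCodd h3 hp3
        hr hX hsurj S hSp hgood hB V C hC' hV hf ϖm hϖm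

end X4

/-! ### X4♯(G-ord) ∩ `I₀*`: the class ENDs with `hDel` replaced -/

section Gord

variable {W : WeierstrassCurve ℚ} [W.IsElliptic] [W.IsGloballyMinimal] {p : ℕ} [hp : Fact p.Prime]

/-- **X4♯(G-ord) ∩ `I₀*`, `r_an = 0`, big image, `p ∤ Tam(E)`: `Typed.MissingUpperBoundAt W p` from the
typed `χ_p`-branch inputs, with Delbourgo 1998 Prop. 4 REPLACED by Greenberg's Prop. 4.14 record.**
The semistable-twist datum is `ClassX4Gord.exists_goodOrd_pStar_twist_model`, the newform / period
ratios are `hmodD`'s, the socket above `p` is T-T3B F7 (`= ⊥` for every `ℤ_p`-extension, hence finite),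
`p ∤ #E(ℚ)_tors` is `Irr`. Binders vs additive-p2's `…_of_chiBranch`: REMOVED `hDel`; ADDED `h414`,
`S`, `hgood`, `hB`. [cite: GreenbergLNM1716, Prop. 4.14] [cite: EdixhovenManin1991, §1] -/
theorem ClassX4Gord.missingUpperBoundAt_rankZero_of_chiBranch_of_prop414
    (h414 : Greenberg1999.prop414_noFiniteSubmodule_of_not_dvd_torsionOrder)
    (hGZK : rank_eq_analyticRank_of_analyticRank_le_one) (hmod : hasEntireLFunction_rat)
    (hmodD : nonempty_modularParametrizationData)
    (hBCeven : ChiBranchLeadingTermBigImageAt W p) (hBCodd : ChiBranchLeadingTermOddBigImageAt W p)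
    (hX : ClassX4Gord W p) (he : semistabilityIndex W p = 2) (hr : W.analyticRank = 0)
    (hsurj : Surj W p) (hram3 : p = 3 → Ram W p) (S : Finset (HeightOneSpectrum (𝓞 ℚ)))
    (hgood : ∀ v ∉ S, (p : 𝓞 ℚ) ∉ v.asIdeal ∧ W.HasGoodReductionAt v) (hB : ¬ p ∣ W.tamagawaProduct) :
    MissingUpperBoundAt W p := by
  obtain ⟨V, iV, iVm, C, hV, hC⟩ := hX.exists_goodOrd_pStar_twist_model W p he
  haveI : NeZero (V.conductorNorm ℤ) := ⟨(V.conductorNorm_pos_holds).ne'⟩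
  obtain ⟨Dm⟩ := hmodD V
  obtain ⟨ϖ, -, hϖ, -⟩ := Dm.exists_rat_mul_realPeriodRat_eq_plusPeriod
  obtain ⟨ϖ', -, hϖ'⟩ := exists_rat_mul_imaginaryPeriodRat_eq_minusPeriod Dm
  exact X4RankZeroTwist.missingUpperBoundAt_of_odd_prime_of_surj_of_prop414 W p h414 hGZK hmod hBCeven
    hBCodd hX.addv.1 hr hX.classX4 hsurj hram3 S
    (fun κ _ v _ hpv ↦ by
      rw [GoodModelLine.ClassX4Gord.localTowerKerPrimary_zero_eq_bot hX hpv κ]; infer_instance)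
    hgood hB V C hC (Or.inl hV) Dm.isNewformOf ϖ hϖ ϖ' hϖ'

/-- **X4♯(G-ord) ∩ `I₀*`, `r_an = 0`, `ρ̄_{E,p}` onto (`ram(3)` if `p = 3`), `p ∤ Tam(E)`: the UPPER
half `ord_p #Ш(E) ≤ ord_p #Ш_an(E)` from the named facts {Kato 17.4 (3) component reading, GREENBERG
PROP. 4.14, GZK, modularity} — Delbourgo 1998 Prop. 4 NOT among them** (additive-p2's
`…_of_katoComponent` with `hDel ↦ h414 + S/hgood + hB`; the branch inputs DISCHARGED by
`chiBranchLeadingTerm[Odd]BigImageAt_of_katoComponent`). [cite: Kato2004Asterisque, Thm. 17.4 (3) (p. 273)]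
[cite: GreenbergLNM1716, Prop. 4.14] -/
theorem ClassX4Gord.missingUpperBoundAt_rankZero_of_katoComponent_of_prop414
    (hK : Kato2004.charIdeal_dvd_padicLFunctionBranch_component_of_surjective)
    (h414 : Greenberg1999.prop414_noFiniteSubmodule_of_not_dvd_torsionOrder)
    (hGZK : rank_eq_analyticRank_of_analyticRank_le_one) (hmod : hasEntireLFunction_rat)
    (hmodD : nonempty_modularParametrizationData)
    (hX : ClassX4Gord W p) (he : semistabilityIndex W p = 2) (hr : W.analyticRank = 0)
    (hsurj : Surj W p) (hram3 : p = 3 → Ram W p) (S : Finset (HeightOneSpectrum (𝓞 ℚ)))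
    (hgood : ∀ v ∉ S, (p : 𝓞 ℚ) ∉ v.asIdeal ∧ W.HasGoodReductionAt v) (hB : ¬ p ∣ W.tamagawaProduct) :
    MissingUpperBoundAt W p :=
  ClassX4Gord.missingUpperBoundAt_rankZero_of_chiBranch_of_prop414 h414 hGZK hmod hmodD
    (chiBranchLeadingTermBigImageAt_of_katoComponent W p hK
      (padicValRat_j_nonneg_of_typeGOrd W p hX.typeGOrd))
    (chiBranchLeadingTermOddBigImageAt_of_katoComponent W p hK
      (padicValRat_j_nonneg_of_typeGOrd W p hX.typeGOrd))
    hX he hr hsurj hram3 S hgood hB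

/-- **… and `BSD(E,p)` on the `p ∤ #Ш_an(E)` rows** (Delbourgo-free fact list).
[cite: Kato2004Asterisque, Thm. 17.4 (3) (p. 273)] [cite: GreenbergLNM1716, Prop. 4.14] -/
theorem ClassX4Gord.bsdp_rankZero_of_katoComponent_of_prop414_of_shaAn_unit
    (hK : Kato2004.charIdeal_dvd_padicLFunctionBranch_component_of_surjective)
    (h414 : Greenberg1999.prop414_noFiniteSubmodule_of_not_dvd_torsionOrder)
    (hGZK : rank_eq_analyticRank_of_analyticRank_le_one) (hmod : hasEntireLFunction_rat)
    (hmodD : nonempty_modularParametrizationData)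
    (hX : ClassX4Gord W p) (he : semistabilityIndex W p = 2) (hr : W.analyticRank = 0)
    (hsurj : Surj W p) (hram3 : p = 3 → Ram W p) (S : Finset (HeightOneSpectrum (𝓞 ℚ)))
    (hgood : ∀ v ∉ S, (p : 𝓞 ℚ) ∉ v.asIdeal ∧ W.HasGoodReductionAt v) (hB : ¬ p ∣ W.tamagawaProduct)
    {q : ℚ} (hq : shaAn W = (q : ℂ)) (hv : padicValRat p q = 0) : BSDp W p :=
  bsdp_of_missingPPartAt W p hGZK (by rw [hr]; exact zero_le_one)
    (missingPPartAt_of_upper_of_shaAn_unit W p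
      (ClassX4Gord.missingUpperBoundAt_rankZero_of_katoComponent_of_prop414 hK h414 hGZK hmod hmodD hX he
        hr hsurj hram3 S hgood hB) hq hv)

/-- **… what remains is EXACTLY the lower half**: `X4.MissingInputAt W p ↔ MissingLowerBoundAt W p`
(Delbourgo-free fact list). [cite: Kato2004Asterisque, Thm. 17.4 (3) (p. 273)] [cite: GreenbergLNM1716, Prop. 4.14] -/
theorem ClassX4Gord.missingInputAt_iff_lower_rankZero_of_katoComponent_of_prop414
    (hK : Kato2004.charIdeal_dvd_padicLFunctionBranch_component_of_surjective)
    (h414 : Greenberg1999.prop414_noFiniteSubmodule_of_not_dvd_torsionOrder)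
    (hGZK : rank_eq_analyticRank_of_analyticRank_le_one) (hmod : hasEntireLFunction_rat)
    (hmodD : nonempty_modularParametrizationData)
    (hX : ClassX4Gord W p) (he : semistabilityIndex W p = 2) (hr : W.analyticRank = 0)
    (hsurj : Surj W p) (hram3 : p = 3 → Ram W p) (S : Finset (HeightOneSpectrum (𝓞 ℚ)))
    (hgood : ∀ v ∉ S, (p : 𝓞 ℚ) ∉ v.asIdeal ∧ W.HasGoodReductionAt v) (hB : ¬ p ∣ W.tamagawaProduct) :
    X4.MissingInputAt W p ↔ MissingLowerBoundAt W p :=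
  ⟨fun h ↦ (lower_and_upper_of_missingPPartAt W p h).1, fun h ↦
    missingPPartAt_of_lower_of_upper W p h
      (ClassX4Gord.missingUpperBoundAt_rankZero_of_katoComponent_of_prop414 hK h414 hGZK hmod hmodD hX he
        hr hsurj hram3 S hgood hB)⟩

/-- **… and `BSD(E,p)` from the LOWER half over `ℚ`** (Delbourgo-free fact list).
[cite: Kato2004Asterisque, Thm. 17.4 (3) (p. 273)] [cite: GreenbergLNM1716, Prop. 4.14] -/
theorem ClassX4Gord.bsdp_rankZero_of_katoComponent_of_lower_of_prop414
    (hK : Kato2004.charIdeal_dvd_padicLFunctionBranch_component_of_surjective)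
    (h414 : Greenberg1999.prop414_noFiniteSubmodule_of_not_dvd_torsionOrder)
    (hGZK : rank_eq_analyticRank_of_analyticRank_le_one) (hmod : hasEntireLFunction_rat)
    (hmodD : nonempty_modularParametrizationData)
    (hX : ClassX4Gord W p) (he : semistabilityIndex W p = 2) (hr : W.analyticRank = 0)
    (hsurj : Surj W p) (hram3 : p = 3 → Ram W p) (S : Finset (HeightOneSpectrum (𝓞 ℚ)))
    (hgood : ∀ v ∉ S, (p : 𝓞 ℚ) ∉ v.asIdeal ∧ W.HasGoodReductionAt v) (hB : ¬ p ∣ W.tamagawaProduct)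
    (hlow : MissingLowerBoundAt W p) : BSDp W p :=
  bsdp_of_missingPPartAt W p hGZK (by rw [hr]; exact zero_le_one)
    ((ClassX4Gord.missingInputAt_iff_lower_rankZero_of_katoComponent_of_prop414 hK h414 hGZK hmod hmodD
      hX he hr hsurj hram3 S hgood hB).mpr hlow)

/-- **CAPSTONE — X4♯(G-ord) ∩ `I₀*`, `r_an = 0`, `ρ̄` onto (`ram(3)` if `p = 3`), `p ∤ Tam(E)`, every
odd `p`: `BSD(E,p)` from the typed LOWER input `CycLowerBoundAt W p Dh` and the named facts {Kato
17.4 (3) component, Greenberg Prop. 4.14, GZK, modularity} — NO Delbourgo 1998 / 2002 anywhere**: the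
lower half is T-CTL-TAM♯'s `ClassX4Gord.missingLowerBoundAt_rankZero_of_cycLowerBound_tamagawaSharp`
(control, Tamagawa-free sockets), the upper half this file. X4♯(G-ord) stays CONSTRUCTION-SHAPED (the
typed input is OPEN); nothing booked. [cite: Kato2004Asterisque, Thm. 17.4 (3) (p. 273)]
[cite: GreenbergLNM1716, §3 Lemma 3.3, §4 Thm. 4.1 and Prop. 4.14] [cite: Miller2011LMS, Def. 1.1] -/
theorem ClassX4Gord.bsdp_rankZero_of_katoComponent_of_cycLowerBound_tamagawaSharp_of_prop414
    (hK : Kato2004.charIdeal_dvd_padicLFunctionBranch_component_of_surjective)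
    (h414 : Greenberg1999.prop414_noFiniteSubmodule_of_not_dvd_torsionOrder)
    (hGZK : rank_eq_analyticRank_of_analyticRank_le_one) (hmod : hasEntireLFunction_rat)
    (hmodD : nonempty_modularParametrizationData)
    (hX : ClassX4Gord W p) (he : semistabilityIndex W p = 2) (hr : W.analyticRank = 0)
    (hsurj : Surj W p) (hram3 : p = 3 → Ram W p) (S : Finset (HeightOneSpectrum (𝓞 ℚ)))
    (hgood : ∀ v ∉ S, (p : 𝓞 ℚ) ∉ v.asIdeal ∧ W.HasGoodReductionAt v) (hB : ¬ p ∣ W.tamagawaProduct)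
    (Dh : PAdicHeightData W p) (hlow : CycLowerBoundAt W p Dh) : BSDp W p :=
  ClassX4Gord.bsdp_rankZero_of_katoComponent_of_lower_of_prop414 hK h414 hGZK hmod hmodD hX he hr hsurj
    hram3 S hgood hB
    (ClassX4Gord.missingLowerBoundAt_rankZero_of_cycLowerBound_tamagawaSharp hX hGZK hr S hgood Dh hlow)

end Gord

end Summit.BirchSwinnertonDyer.Rank1Residual.Additive

end
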